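import Mathlib
import Summits.Ventures.PercRepro2.CoinKSureTailSums
import Summits.Ventures.PercRepro2.CoinChainLayerCakeDarc

/-!
# Row 2′DARC at the general chain under the layer-cake condition on the SECOND marker
(blind cell PercRepro2, night-2 g21; proofs/NIGHT2-DARC.md §61)

`darc_of_chain_of_layerCake` takes its two numeric conditions on `m₁`; the row is symmetric in
the two markers (`darc_swap`), so the same conditions on `m₂` close it as well.
-/

namespace Summit.Ventures.PercRepro2.Coin

open Classical

section LayerCakeDarcSwap

variable {V : Type*} {E : Type*} [Fintype V] [DecidableEq V] [Fintype E] [DecidableEq E]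
  {R : Type*} [Field R] [LinearOrder R] [IsStrictOrderedRing R]
  {arcs : E → Finset (V × V)} {s : V} {U : Finset V} {ent ent' : Finset V} {c' : V → E}
  {a' a w : V} {c : V → E}

/-- **ROW 2′DARC AT THE GENERAL CHAIN UNDER THE LAYER-CAKE CONDITION ON THE SECOND MARKER**: the gate
lowers the mean of `m₂` and the coin-closed gate keeps it above the chain `R`-mean; nothing is
assumed on `m₁`. -/
theorem darc_of_chain_of_layerCake' (pr : E → R) (hp : IsProbVec pr) (hS : SameEnds arcs)
    (h' : OrTailK arcs s U ent' c' a') (hsure' : ∀ r ∈ ent', pr (c' r) = 1)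
    (h : OrTailK arcs s (insert a' U) (insert a' ent) c a) (hsure : ∀ r ∈ ent, pr (c r) = 1)
    (hentU : ent ⊆ U)
    {m₁ m₂ : V} (hm₁ : m₁ ∈ U) (hm₂ : m₂ ∈ U)
    (hν : ∀ W W', W ⊆ U → W' ⊆ U →
      prob pr (coreLevel arcs s U W) * prob pr (coreLevel arcs s U W') ≤
        prob pr (coreLevel arcs s U (W ∩ W')) * prob pr (coreLevel arcs s U (W ∪ W')))
    {t : V} (htC : t ∉ insert a (insert a' U)) (hts : t ≠ s) (hws : w ≠ s)
    (hwC : w ∉ insert a (insert a' U))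
    (hSy : (∑ W ∈ U.powerset, prob pr (coreLevel arcs s U W) *
            chainMix ent ent' (pr (c a')) (chainC pr arcs s t U ent' a' a) (chainD' pr arcs s t U ent' a' a w) W *
            (if m₂ ∈ W then (1 : R) else 0)) *
          (∑ W ∈ U.powerset, prob pr (coreLevel arcs s U W) *
            chainMix ent ent' (pr (c a')) (chainC pr arcs s t U ent' a' a) (chainD pr arcs s t U ent' a' a) W) ≤
        (∑ W ∈ U.powerset, prob pr (coreLevel arcs s U W) *
            chainMix ent ent' (pr (c a')) (chainC pr arcs s t U ent' a' a) (chainD' pr arcs s t U ent' a' a w) W) *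
          (∑ W ∈ U.powerset, prob pr (coreLevel arcs s U W) *
            chainMix ent ent' (pr (c a')) (chainC pr arcs s t U ent' a' a) (chainD pr arcs s t U ent' a' a) W *
            (if m₂ ∈ W then (1 : R) else 0)))
    (hG0y : (∑ W ∈ U.powerset, prob pr (coreLevel arcs s U W) *
            chainMix ent ent' 0 (chainC pr arcs s t U ent' a' a) (chainD' pr arcs s t U ent' a' a w) W) *
          (∑ W ∈ U.powerset, prob pr (coreLevel arcs s U W) *
            chainMix ent ent' (pr (c a')) (chainC pr arcs s t U ent' a' a) (chainD pr arcs s t U ent' a' a) W *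
            (if m₂ ∈ W then (1 : R) else 0)) ≤
        (∑ W ∈ U.powerset, prob pr (coreLevel arcs s U W) *
            chainMix ent ent' 0 (chainC pr arcs s t U ent' a' a) (chainD' pr arcs s t U ent' a' a w) W *
            (if m₂ ∈ W then (1 : R) else 0)) *
          (∑ W ∈ U.powerset, prob pr (coreLevel arcs s U W) *
            chainMix ent ent' (pr (c a')) (chainC pr arcs s t U ent' a' a) (chainD pr arcs s t U ent' a' a) W)) :
    DARC pr arcs s {t} m₁ m₂ a w :=
  (darc_swap pr arcs s {t} m₂ m₁ a w).1
    (darc_of_chain_of_layerCake pr hp hS h' hsure' h hsure hentU hm₂ hm₁ hν htC hts hws hwC hSy hG0y)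

end LayerCakeDarcSwap

end Summit.Ventures.PercRepro2.Coin
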